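import Summits.KontsevichZagierPeriods.KontsevichZagierPeriods.Theses.CarlsonRule
import Literature.NumberTheory.Transcendental.KZKernelConjectureForms

/-!
# Crux `CarlsonKernel` (stmt-KontsevichZagierPeriods-14426) — birth skeleton (`Lines/birth.lean`, BC3)

Route `CarlsonRule`, crux #6 `CarlsonKernel` = **Conjecture 1 for the calculus KZ^C** (the four moves +
CARLSON'S RULE as an ω-rule): for every subgroup `R ≥ KZ.relations` of the formal group that is closed
under the rule (premisses `[r m] − [s m] ∈ R` for all `m ∈ ℕ`, `0 ≤ g, g' ≤ M`; conclusion
`[σ, f·g^k] − [τ, f'·g'^k] ∈ R` for rational `k ≥ 0`), `ker KZ.eval ⊆ R`.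

## The cut — the Γ-Hodge seam, transplanted into KZ^C

Carlson's rule interpolates EXPONENTS; its home sector is the Γ-sector (products of Beta values at
rational arguments: Gauss multiplication, Selberg/Morris/Opdam constants, Dougall — the route header's
"coset wall"). The tree already carries a typed seam of exactly this shape for the plain calculus —
`KontsevichZagierPeriods ⇐ GammaHodgeSector ∧ CompleteModGammaSector` (routes TerasomaMultiplication /
MotivatedMoves, `closes` proved) — and this skeleton cuts the crux along the same seam ONE CALCULUS UP:

* `stub_gammaHodgeInCarlson : GammaHodgeInCarlson` (written out one level; conjecture-grade, NEW, the rule's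
  obligation):
  **KZ^C derives Deligne's Γ-Hodge identities** — for every Carlson-closed `R ≥ relations`, the difference
  `[ρ] − [ρ']` of every Deligne–Koblitz–Ogus Γ-Hodge pair (hypotheses VERBATIM those of item
  stmt-KontsevichZagierPeriods-3742 `GammaHodgeSector`: positive non-integer rational exponents, the
  decidable Hodge-type condition via `Int.fract`, `c` real algebraic, equal values) lies in `R`.
  It CONSUMES the closure hypothesis H2: the Koblitz–Ogus span (translation = Newton–Leibniz; reflection at
  rationals = arctan/log unfolding, `ReflectionThird` proved; MULTIPLICATION in every parameter = integer
  points, which are identities between rational numbers, + the rule) is where interpolation in the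
  exponent is the tool; the residue is the Yamamoto–Das gap classes (`2a ∈ span, a ∉ span`: the rule
  gives `2·([ρ] − [ρ']) ∈ R`; `DasGapTwelve`, N = 12, is PROVED accessible directly; N = 15, 20, … open).
  Without H2 it would be `GammaHodgeSector` itself (strictly harder); it is a special case of the crux
  (`containsGammaHodgePairs_of_carlsonKernel` below, sorry-free) and a consequence of the summit.
* `stub_completeModGammaHodge : CompleteModGammaHodge` (written out one level; conjecture-grade) **= item
  stmt-KontsevichZagierPeriods-14233 `TerasomaMultiplication.CompleteModGammaSector` VERBATIM**
  (Conjecture 1 for the Γ-enlarged calculus: every `H ≥ relations` containing all Γ-Hodge pair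
  differences contains `[r] − [r']` for all rational-shape `r, r'` of equal value). Shared obligation:
  it closes when stmt-14233 closes (not re-filed; restated here only because a cross-route `Theses` import
  would not survive that route's rewrites — identity checked `Iff.rfl` in the registrar's folder,
  `bc/verbatim_check.lean`, rc 0).

Composition `CarlsonKernel_of_stubs : GammaHodgeInCarlson → CompleteModGammaHodge → (CarlsonKernel, unfolded
by Iff.rfl)` (real proof, no `sorry`) and `CarlsonKernel_of : CarlsonKernel` (by name, the stubs fed in — the
audit admits no inline hypotheses on the by-name theorem): given `R`, H1 `relations ≤ R`, H2
`ClosedUnderCarlson R` and `c` with `eval c = 0`: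
stub 1 puts the Γ-Hodge pairs in `R`; bookkeeping (`KZ.exists_integralRep_sub_holds`,
`KZ.exists_isRational_equivalent_holds`, soundness `KZ.relations_le_ker_eval_holds` /
`KZ.Equivalent.value_eq_holds`) writes `c ≡ [r] − [r'] ≡ [ρ] − [ρ']` modulo relations with `ρ, ρ'`
of KZ's literal shape and equal value; stub 2 at `H := R` gives `[ρ] − [ρ'] ∈ R`; climb back through
H1. `CarlsonKernel_of`'s only `sorryAx` dependencies are the two `stub_*` theorems.

## Disproof used (Cruxes/CarlsonKernel/Attack.lean, refuter crux-attack, all kernel-checked there)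

* `carlsonKernel_false_without_relationsLe` (H1 load-bearing): H1 is used by BOTH stubs (hypothesis
  `relations ≤ R` / `≤ H`) and three times in the composition.
* `withoutClosure_iff_summit` (H2 deleted = the summit): H2 is CONSUMED by `stub_gammaHodgeInCarlson`
  — the skeleton is not "Conjecture 1 with the rule carried along": drop H2 from stub 1 and it becomes
  the plain-calculus crux `GammaHodgeSector` (stmt-3742).
* `not_allMem` (guard `eval c = 0` load-bearing): used (value bookkeeping `hval`).
* §9 there (`carlsonSound_holds`, `carlsonClosure ≤ ker eval`): KZ^C is sound, so neither stub asserts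
  membership of a non-zero-value combination; both stubs are consequences of the summit
  (`stubs_of_summit` below, sorry-free) — no stub is refutable short of refuting Kontsevich–Zagier.
* Negatives index (`ledger negatives`): 1 entry (KinematicPlaneConvex, `K = ∅` witness) — unrelated;
  degenerate data here: `N = N' = k = 0` gives `ρ = ρ' =` empty products with equal values, harmless.

BC3 probes (registrar's folder `bc/probe_P1…P4_*.lean`, attached as item evidence; defs copied verbatim, no
stub/skeleton theorem in scope): `GammaHodgeInCarlson → CarlsonKernel`, `GammaHodgeInCarlson → KontsevichZagierPeriods`,
`CompleteModGammaHodge → CarlsonKernel`, `CompleteModGammaHodge → KontsevichZagierPeriods` by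
`first | exact? | simpa [·] | (unfold ·; simpa) | aesop` and each alternative alone — all FAIL (rc 1; table in
`Lines/birth.md`).
-/

noncomputable section

set_option linter.dupNamespace false

open Literature.NumberTheory.Transcendental

namespace Summit.KontsevichZagierPeriods.KontsevichZagierPeriods.Cruxes.CarlsonKernel.Birth

open Summit.KontsevichZagierPeriods.KontsevichZagierPeriods.Theses.CarlsonRule (CarlsonKernel CarlsonClosure)

/-! ### Vocabulary (verbatim fragments of route items) -/

/-- `R` is closed under CARLSON'S RULE — the closure hypothesis of the crux `CarlsonKernel`, VERBATIM
(premisses `[r m] − [s m] ∈ R` for all `m ∈ ℕ`, conclusion `[rk] − [sk] ∈ R` for rational `k ≥ 0`).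
[cite: KontsevichZagier2001, §1.2] -/
def ClosedUnderCarlson (R : AddSubgroup KZ.FormalRep) : Prop :=
  ∀ (n n' : ℕ) (σ : Set (Fin n → ℝ)) (τ : Set (Fin n' → ℝ)) (f g : (Fin n → ℝ) → ℝ)
    (f' g' : (Fin n' → ℝ) → ℝ) (M : ℝ) (r : ℕ → KZ.IntegralRep n) (s : ℕ → KZ.IntegralRep n'),
    (∀ x ∈ σ, 0 ≤ g x ∧ g x ≤ M) → (∀ y ∈ τ, 0 ≤ g' y ∧ g' y ≤ M) →
    (∀ m, (r m).domain = σ ∧ Set.EqOn (r m).integrand (fun x => f x * g x ^ m) σ) →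
    (∀ m, (s m).domain = τ ∧ Set.EqOn (s m).integrand (fun y => f' y * g' y ^ m) τ) →
    (∀ m, KZ.of (r m) - KZ.of (s m) ∈ R) →
    ∀ (k : ℚ), 0 ≤ k → ∀ (rk : KZ.IntegralRep n) (sk : KZ.IntegralRep n'),
      rk.domain = σ → Set.EqOn rk.integrand (fun x => f x * g x ^ (k : ℝ)) σ →
      sk.domain = τ → Set.EqOn sk.integrand (fun y => f' y * g' y ^ (k : ℝ)) τ →
      KZ.of rk - KZ.of sk ∈ R

/-- `H` contains the difference `[ρ] − [ρ']` of every Deligne–Koblitz–Ogus Γ-HODGE PAIR — the sector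
hypothesis of item stmt-KontsevichZagierPeriods-14233 `CompleteModGammaSector`, VERBATIM (the pairs are
exactly those of item stmt-KontsevichZagierPeriods-3742 `GammaHodgeSector`: cube representation
`[(0,1)^N, Π t_j^(x_j−1)(1−t_j)^(y_j−1)]` against `[unit 2k-ball × (0,1)^N', c·k!·Π(…)]`, positive
non-integer rational exponents, Hodge-type condition for every `u` coprime to the denominators, `c` real
algebraic, equal values). [cite: Deligne1982HodgeCycles, Thm 7.18] [cite: KontsevichZagier2001, §1.2] -/
def ContainsGammaHodgePairs (H : AddSubgroup KZ.FormalRep) : Prop :=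
  ∀ (N N' k : ℕ) (x y : Fin N → ℚ) (x' y' : Fin N' → ℚ) (c : ℝ),
    (∀ j, 0 < x j ∧ 0 < y j ∧ Int.fract (x j) ≠ 0 ∧ Int.fract (y j) ≠ 0) →
    (∀ l, 0 < x' l ∧ 0 < y' l ∧ Int.fract (x' l) ≠ 0 ∧ Int.fract (y' l) ≠ 0) →
    (∀ u : ℕ, 0 < u → (∀ j, Nat.Coprime u (x j).den ∧ Nat.Coprime u (y j).den) →
      (∀ l, Nat.Coprime u (x' l).den ∧ Nat.Coprime u (y' l).den) →
      ((∑ j, (Int.fract ((u : ℚ) * x j) + Int.fract ((u : ℚ) * y j) - Int.fract ((u : ℚ) * (x j + y j)))) -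
        ∑ l, (Int.fract ((u : ℚ) * x' l) + Int.fract ((u : ℚ) * y' l) - Int.fract ((u : ℚ) * (x' l + y' l))))
        = (k : ℚ)) →
    IsAlgebraic ℚ c →
    ∀ (ρ : KZ.IntegralRep N) (ρ' : KZ.IntegralRep (2 * k + N')),
      ρ.domain = {t | ∀ j, t j ∈ Set.Ioo (0:ℝ) 1} →
      Set.EqOn ρ.integrand (fun t => ∏ j, (t j) ^ ((x j : ℝ) - 1) * (1 - t j) ^ ((y j : ℝ) - 1)) ρ.domain →
      ρ'.domain = {z | (∑ i : Fin (2 * k), (z (Fin.castAdd N' i)) ^ 2) < 1 ∧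
        ∀ l : Fin N', z (Fin.natAdd (2 * k) l) ∈ Set.Ioo (0:ℝ) 1} →
      Set.EqOn ρ'.integrand (fun z => c * (k.factorial : ℝ) *
        ∏ l, (z (Fin.natAdd (2 * k) l)) ^ ((x' l : ℝ) - 1) * (1 - z (Fin.natAdd (2 * k) l)) ^ ((y' l : ℝ) - 1))
        ρ'.domain →
      ρ.value = ρ'.value → KZ.of ρ - KZ.of ρ' ∈ H

/-- The crux unfolds, BY `Iff.rfl`, to: every Carlson-closed `R ≥ relations` contains every combination of
value `0` (so `ClosedUnderCarlson` above is the crux's hypothesis verbatim). [cite: KontsevichZagier2001, §1.2] -/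
theorem carlsonKernel_iff :
    CarlsonKernel ↔ ∀ R : AddSubgroup KZ.FormalRep, KZ.relations ≤ R → ClosedUnderCarlson R →
      ∀ c : KZ.FormalRep, KZ.eval c = 0 → c ∈ R :=
  Iff.rfl

/-! ### The two stub STATEMENTS -/

/-- **Stub statement 1 (conjecture-grade; the rule's obligation) — KZ^C DERIVES THE Γ-HODGE SECTOR.**
For every subgroup `R ≥ KZ.relations` closed under Carlson's rule, `R` contains the difference of every
Deligne–Koblitz–Ogus Γ-Hodge pair of equal value. Plan: the Koblitz–Ogus span of the Hodge-type lattice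
is generated by translation (Newton–Leibniz, in `relations`), reflection at rational arguments
(arctan/log unfolding; `TerasomaMultiplication.ReflectionThird` proved, `CompiledSubstitutions.
EulerReflectionRational` filed) and the multiplication relations in each parameter — THESE are exponent
families `[σ, f·g^m]` whose integer members are identities between rational numbers (accessible by
polynomial / radical primitives and box rescaling) and whose rational members the rule delivers
(`TerasomaMultiplication.MultiplicationAccessible`, proved the hard way, is the one-parameter pure-Beta
instance); the `π^k`-carrier is reflection. Residue = the Yamamoto–Das gap classes (`2a` in the span,
`a` not): the rule yields `2·([ρ] − [ρ']) ∈ R` and the class itself needs a direct chain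
(`TerasomaMultiplication.DasGapTwelve`, N = 12, PROVED) or 2-torsion-freeness of `FormalRep ⧸ R`.
Why it might fail: a gap class (N = 15, 20, 21, …) with no chain and no division by 2 inside KZ^C; it
is a special case of the crux and a consequence of the summit, so a refutation refutes Kontsevich–Zagier.
Size: XL / conjecture-grade. [cite: Deligne1982HodgeCycles, Thm 7.18] [cite: KoblitzOgus1979]
[cite: Das2000] [cite: AndrewsAskeyRoy1999, Thm 2.8.1] [cite: KontsevichZagier2001, §1.2] -/
def GammaHodgeInCarlson : Prop :=
  ∀ R : AddSubgroup KZ.FormalRep, KZ.relations ≤ R → ClosedUnderCarlson R → ContainsGammaHodgePairs R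

/-- **Stub statement 2 (conjecture-grade) = item stmt-KontsevichZagierPeriods-14233
`TerasomaMultiplication.CompleteModGammaSector`, VERBATIM** — CONJECTURE 1 FOR THE Γ-ENLARGED CALCULUS:
for every subgroup `H ≥ KZ.relations` containing all Γ-Hodge pair differences and all rational-shape
representations `r, r'` (KZ §1.1) of equal value, `[r] − [r'] ∈ H`. The complement of the Γ-Hodge sector
(mixed Tate / MZV, non-CM elliptic, modular, … periods): GPC-strength, shared with routes
TerasomaMultiplication (crux #7) and MotivatedMoves (sup form stmt-10378); closes when stmt-14233 closes.
Why it might fail: one additive invariant of `FormalRep` vanishing on the moves and the Γ-pairs but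
separating a rational pair refutes it — and the summit. [cite: KontsevichZagier2001, §1.2 Conjecture 1]
[cite: HuberMullerStachPeriods2017, Ch. 13] [cite: Ayoub2014] -/
def CompleteModGammaHodge : Prop :=
  ∀ H : AddSubgroup KZ.FormalRep, KZ.relations ≤ H → ContainsGammaHodgePairs H →
    ∀ ⦃n m : ℕ⦄ (r : KZ.IntegralRep n) (r' : KZ.IntegralRep m),
      r.IsRational → r'.IsRational → r.value = r'.value → KZ.of r - KZ.of r' ∈ H

/-! ### Registered stubs (the ONLY `sorry`s of this file) -/

/-- **STUB 1** — KZ^C derives the Γ-Hodge sector: the statement `GammaHodgeInCarlson` (docstring there),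
written out one level so that the registered signature shows its shape (definitionally the same).
[cite: Deligne1982HodgeCycles, Thm 7.18] [cite: KontsevichZagier2001, §1.2] -/
theorem stub_gammaHodgeInCarlson :
    ∀ R : AddSubgroup KZ.FormalRep, KZ.relations ≤ R → ClosedUnderCarlson R →
      ContainsGammaHodgePairs R := by
  sorry

/-- **STUB 2** — Conjecture 1 for the Γ-enlarged calculus: the statement `CompleteModGammaHodge` (= item
stmt-KontsevichZagierPeriods-14233 verbatim), written out one level (definitionally the same). [cite: KontsevichZagier2001, §1.2 Conjecture 1] -/
theorem stub_completeModGammaHodge :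
    ∀ H : AddSubgroup KZ.FormalRep, KZ.relations ≤ H → ContainsGammaHodgePairs H →
      ∀ ⦃n m : ℕ⦄ (r : KZ.IntegralRep n) (r' : KZ.IntegralRep m),
        r.IsRational → r'.IsRational → r.value = r'.value → KZ.of r - KZ.of r' ∈ H := by
  sorry

/-! ### Composition (no `sorry` below this line) -/

/-- **Composition (real proof; hypotheses = the two stub statements; conclusion = the crux `CarlsonKernel`
unfolded by `Iff.rfl`, cf. `carlsonKernel_iff`)** — the mechanical skeleton audit admits no inline `Prop`
hypotheses on the theorem that concludes the crux BY NAME, so the arrows live here and `CarlsonKernel_of`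
below feeds the registered stubs in (same shape as the registered PhiFourKernelH / OrientationKernel
skeletons). Stub 1 consumes the Carlson closure of `R` to put the Γ-Hodge pairs in `R`; the bookkeeping
facts of the calculus reduce a vanishing combination `c` to a difference `[ρ] − [ρ']` of two rational-shape
representations of equal value modulo `relations ≤ R`; stub 2 at `H := R` puts that difference in `R`.
[cite: KontsevichZagier2001, §1.2 Conjecture 1] -/
theorem CarlsonKernel_of_stubs : GammaHodgeInCarlson → CompleteModGammaHodge →
    ∀ R : AddSubgroup KZ.FormalRep, KZ.relations ≤ R → ClosedUnderCarlson R →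
      ∀ c : KZ.FormalRep, KZ.eval c = 0 → c ∈ R := by
  intro h₁ h₂ R hRel hC c hc
  -- stub 1: the Γ-Hodge pairs lie in `R` (uses H1 and CONSUMES H2)
  have hΓ : ContainsGammaHodgePairs R := h₁ R hRel hC
  -- bookkeeping: `c ≡ [r] − [r']` modulo moves, `r ~ ρ`, `r' ~ ρ'` of KZ's literal (rational) shape
  obtain ⟨n, m, r, r', hrel⟩ := KZ.exists_integralRep_sub_holds c
  obtain ⟨N, ρ, hρ, hrρ⟩ := KZ.exists_isRational_equivalent_holds r
  obtain ⟨N', ρ', hρ', hrρ'⟩ := KZ.exists_isRational_equivalent_holds r'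
  -- soundness: the guard `eval c = 0` becomes `ρ.value = ρ'.value`
  have hval : r.value = r'.value := by
    have h0 : KZ.eval (c - (KZ.of r - KZ.of r')) = 0 := KZ.relations_le_ker_eval_holds hrel
    rwa [map_sub, hc, zero_sub, neg_eq_zero, KZ.eval_of_sub_of, sub_eq_zero] at h0
  have hvalρ : ρ.value = ρ'.value := by
    rw [← KZ.Equivalent.value_eq_holds hrρ, ← KZ.Equivalent.value_eq_holds hrρ', hval]
  -- stub 2 at `H := R`
  have hρρ' : KZ.of ρ - KZ.of ρ' ∈ R := h₂ R hRel hΓ ρ ρ' hρ hρ' hvalρ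
  -- climb back through H1 `relations ≤ R`
  have h1 : KZ.of r - KZ.of ρ ∈ R := hRel hrρ
  have h2 : KZ.of ρ' - KZ.of r' ∈ R := hRel hrρ'.symm
  have hrr' : KZ.of r - KZ.of r' ∈ R := by
    have key : KZ.of r - KZ.of r' =
        (KZ.of r - KZ.of ρ) + (KZ.of ρ - KZ.of ρ') + (KZ.of ρ' - KZ.of r') := by abel
    rw [key]
    exact R.add_mem (R.add_mem h1 hρρ') h2
  have key' : c = (c - (KZ.of r - KZ.of r')) + (KZ.of r - KZ.of r') := by abel
  rw [key']
  exact R.add_mem (hRel hrel) hrr'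

/-- **The skeleton theorem — the crux `CarlsonKernel` BY NAME**: the two registered stubs fed into
`CarlsonKernel_of_stubs` (definitionally `GammaHodgeInCarlson`, `CompleteModGammaHodge`); its only
`sorryAx` dependencies are `stub_gammaHodgeInCarlson`, `stub_completeModGammaHodge`; it is the unique
theorem of this file concluding the crux (skeleton audit). [cite: KontsevichZagier2001, §1.2 Conjecture 1] -/
theorem CarlsonKernel_of : CarlsonKernel :=
  carlsonKernel_iff.mpr (CarlsonKernel_of_stubs stub_gammaHodgeInCarlson stub_completeModGammaHodge)

/-! ### Standing of the stubs (sorry-free sanity: consequences of the summit; stub 1 a special case of the crux) -/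

/-- Stub 1 is a special case of the crux — the kernel statement restricted to the Γ-Hodge sector (this
theorem's type is `CarlsonKernel → GammaHodgeInCarlson` unfolded one step; stated over
`ContainsGammaHodgePairs` so that no audit reads it as a proof of the stub): fine as a stub since it is
USED toward the crux above, and it is not cheaply the crux (BC3 probe fails). [cite: KontsevichZagier2001, §1.2] -/
theorem containsGammaHodgePairs_of_carlsonKernel (hK : CarlsonKernel) (R : AddSubgroup KZ.FormalRep)
    (hRel : KZ.relations ≤ R) (hC : ClosedUnderCarlson R) : ContainsGammaHodgePairs R := by
  intro N N' k x y x' y' c _ _ _ _ ρ ρ' _ _ _ _ hv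
  exact hK R hRel hC _ (by rw [KZ.eval_of_sub_of, hv, sub_self])

/-- Both stubs are consequences of the summit (so neither is refutable short of refuting the
Kontsevich–Zagier conjecture, and the pair is sandwiched: summit ⇒ stubs ⇒ `CarlsonKernel`, while
`CarlsonClosure ∧ CarlsonKernel ⇔` summit by the route's `closes` and `Attack.summit_iff_and'`).
[cite: KontsevichZagier2001, §1.2 Conjecture 1] -/
theorem stubs_of_summit (h : KontsevichZagierPeriods) : GammaHodgeInCarlson ∧ CompleteModGammaHodge := by
  have hK : KZKernelConjecture :=
    kzKernelConjecture_iff_isRational.mpr (KontsevichZagierPeriods_iff.mp h)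
  refine ⟨fun R hRel _ N N' k x y x' y' c _ _ _ _ ρ ρ' _ _ _ _ hv => hRel (hK _ ?_),
    fun H hRel _ n m r r' hr hr' hv => hRel ?_⟩
  · rw [KZ.eval_of_sub_of, hv, sub_self]
  · exact (KontsevichZagierPeriods_iff.mp h) r r' hr hr' hv

end Summit.KontsevichZagierPeriods.KontsevichZagierPeriods.Cruxes.CarlsonKernel.Birth
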